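import Mathlib
import Summits.AtomisticToContinuum.FouriersLaw.Statement
import Summits.AtomisticToContinuum.FouriersLaw.Theses.ContactStieltjesMeasure
import Summits.AtomisticToContinuum.FouriersLaw.Theorems.ContactStieltjesMeasureContactMeasureLimitStieltjesContinuity

/-!
# `ContactMeasureLimit` (crux stmt-AtomisticToContinuum-15250) FOLLOWS FROM FOURIER'S LAW — unconditionally

The crux-disprover (`Cruxes/ContactMeasureLimit/Disproof.lean` §3, refuter cdisprove, 2026-08-17; candidate file
`FLImpliesCML.lean` attached to the item for a prover to land) proved `StieltjesContinuity → FouriersLaw →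
ContactMeasureLimit` with the analysis child as a hypothesis. The analysis child is now the landed theorem
`stieltjesContinuity` (`…ContactMeasureLimitStieltjesContinuity`, p160184), so the implication is UNCONDITIONAL:

* `contactMeasureLimit_of_fouriersLaw : FouriersLaw → ContactMeasureLimit` — clause (i) of `FouriersLawFor`
  discharges the uniqueness premise of the representing hypothesis and (by choice) supplies a steady-state family,
  the `δ`-limit along `𝓝[≠] 0` is unique, so `D_N(γ) = (N-1)·γ·∫₀^∞ Φ_N k_γ` (`N ≥ 2`) and
  `N·∫₀^∞ Φ_N k_γ = (N/(N-1))·D_N(γ)/γ → κ(T)/γ` at EVERY friction; `stieltjesContinuity` applied to `F_N := N·Φ_N`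
  (`N ≥ 2`, else `0`) gives `M`;
* contrapositive (not restated as a declaration): every counterexample to the crux refutes the conjunct itself —
  (M) carries no risk of its own (the disprover's bottom line).
Proof verbatim from the disprover's file up to the discharged hypothesis; standard axioms; no definitions.
-/

noncomputable section

namespace Summit.AtomisticToContinuum.FouriersLaw.Theorems.ContactMeasureLimit

open MeasureTheory Filter Set Topology
open Summit.AtomisticToContinuum.FouriersLaw.Theses.ContactStieltjesMeasure

open Literature.MathematicalPhysics.KineticTheory.HeatConduction (pinnedChain PhaseSpace) in
/-- **(M) FOLLOWS FROM FOURIER'S LAW, unconditionally.** If `FouriersLaw` holds then every family `Φ` satisfying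
the crux's representing hypothesis has convergent scaled transforms at EVERY friction, and the landed Stieltjes
continuity theorem `stieltjesContinuity` gives the monotone limit `M` (disprover's §3 with its analysis
hypothesis discharged). [folklore] -/
theorem contactMeasureLimit_of_fouriersLaw :
    _root_.FouriersLaw →
      Summit.AtomisticToContinuum.FouriersLaw.Theses.ContactStieltjesMeasure.ContactMeasureLimit := by
  intro hFL ω₂ lam β hω hl hβ T hT Φ hΦ
  classical
  -- the scaled family, made structural at EVERY `N`
  let F : ℕ → ℝ → ℝ := fun N t => if 2 ≤ N then (N : ℝ) * Φ N t else 0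
  have hF2 : ∀ N : ℕ, 2 ≤ N → ∀ t : ℝ, F N t = (N : ℝ) * Φ N t := fun N hN t => if_pos hN
  have hFlt : ∀ N : ℕ, ¬ 2 ≤ N → ∀ t : ℝ, F N t = 0 := fun N hN t => if_neg hN
  have hstruct : ∀ N : ℕ, Monotone (F N) ∧ (∀ s : ℝ, s ≤ 0 → F N s = 0) ∧
      (∃ m : ℝ, ∀ s : ℝ, F N s ≤ m) := by
    intro N
    by_cases hN : 2 ≤ N
    · obtain ⟨hmono, hzero, ⟨m, hm⟩, -⟩ := hΦ N hN
      refine ⟨fun a b hab => ?_, fun s hs => ?_, ⟨(N : ℝ) * m, fun s => ?_⟩⟩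
      · rw [hF2 N hN, hF2 N hN]
        exact mul_le_mul_of_nonneg_left (hmono hab) (Nat.cast_nonneg N)
      · rw [hF2 N hN, hzero s hs, mul_zero]
      · rw [hF2 N hN]
        exact mul_le_mul_of_nonneg_left (hm s) (Nat.cast_nonneg N)
    · refine ⟨fun a b _ => ?_, fun s _ => hFlt N hN s, ⟨0, fun s => ?_⟩⟩
      · rw [hFlt N hN, hFlt N hN]
      · rw [hFlt N hN]
  -- the scaled transforms converge at every friction: Fourier's law AT THAT FRICTION
  have htrans : ∀ γ : ℝ, 0 < γ → ∃ L : ℝ, Tendsto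
      (fun N : ℕ => ∫ t in Ioi (0 : ℝ), F N t * (2 * t / (γ ^ 2 + t ^ 2) ^ 2)) atTop (𝓝 L) := by
    intro γ hγ
    obtain ⟨hEU, κ, -, hresp⟩ := hFL ω₂ lam β γ hω hl hβ hγ
    have huniq : ∀ (N' : ℕ) (T_L T_R : ℝ), 0 < T_L → 0 < T_R →
        ∀ μ ν : Measure (PhaseSpace N'),
          (pinnedChain ω₂ lam β γ).IsSteadyState N' T_L T_R μ →
            (pinnedChain ω₂ lam β γ).IsSteadyState N' T_L T_R ν → μ = ν := by
      intro N' T_L T_R hL hR μ ν hμ hν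
      obtain ⟨μ₀, -, hall⟩ := hEU N' T_L T_R hL hR
      exact (hall μ hμ).trans (hall ν hν).symm
    let μf : (N' : ℕ) → ℝ → ℝ → Measure (PhaseSpace N') := fun N' T_L T_R =>
      if h : 0 < T_L ∧ 0 < T_R then Classical.choose (hEU N' T_L T_R h.1 h.2) else 0
    have hμf : ∀ (N' : ℕ) (T_L T_R : ℝ), 0 < T_L → 0 < T_R →
        (pinnedChain ω₂ lam β γ).IsSteadyState N' T_L T_R (μf N' T_L T_R) := by
      intro N' T_L T_R hL hR
      simp only [μf, dif_pos (And.intro hL hR)]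
      exact (Classical.choose_spec (hEU N' T_L T_R hL hR)).1
    obtain ⟨D, hD, hDlim⟩ := hresp μf hμf T hT
    have hDN : ∀ N : ℕ, 2 ≤ N → D N = ((N : ℝ) - 1) * γ *
        ∫ t in Ioi (0 : ℝ), Φ N t * (2 * t / (γ ^ 2 + t ^ 2) ^ 2) :=
      fun N hN => tendsto_nhds_unique (hD N) ((hΦ N hN).2.2.2 γ hγ huniq μf hμf)
    have hfrac : Tendsto (fun N : ℕ => (N : ℝ) / ((N : ℝ) - 1)) atTop (𝓝 1) := by
      have h := tendsto_natCast_div_add_atTop (-1 : ℝ)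
      refine h.congr fun N => ?_
      rw [← sub_eq_add_neg]
    refine ⟨1 * (κ T / γ), ?_⟩
    refine (hfrac.mul (hDlim.div_const γ)).congr' ?_
    filter_upwards [eventually_ge_atTop 2] with N hN
    have hN1 : (N : ℝ) - 1 ≠ 0 := by
      have : (2 : ℝ) ≤ N := by exact_mod_cast hN
      linarith
    have hfun : (fun t : ℝ => F N t * (2 * t / (γ ^ 2 + t ^ 2) ^ 2)) =
        fun t : ℝ => (N : ℝ) * (Φ N t * (2 * t / (γ ^ 2 + t ^ 2) ^ 2)) := by
      funext t; rw [hF2 N hN]; ring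
    rw [hfun, integral_const_mul, hDN N hN]
    generalize (∫ t in Ioi (0 : ℝ), Φ N t * (2 * t / (γ ^ 2 + t ^ 2) ^ 2)) = I
    rw [mul_assoc (((N : ℝ) - 1)) γ I, mul_comm γ I, ← mul_assoc, mul_div_assoc,
      div_self hγ.ne', mul_one, ← mul_assoc, div_mul_cancel₀ _ hN1]
  obtain ⟨M, hMmono, hM⟩ := stieltjesContinuity F hstruct htrans
  refine ⟨M, hMmono, fun t ht hcont => ?_⟩
  refine (hM t ht hcont).congr' ?_
  filter_upwards [eventually_ge_atTop 2] with N hN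
  exact hF2 N hN t


end Summit.AtomisticToContinuum.FouriersLaw.Theorems.ContactMeasureLimit

end
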